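import Summits.QuantumFields.YangMills.Theorems.AlphaInputsT3ACv2Data
import HarnessLib

/-!
# `AlphaInputsT3ACv2Histories` — the version-2 datum's HISTORY FUNCTIONAL OPENED as the interface's `LFData` (`OfV2.lfDataT3c`) with `LFSum`
# PROVED, the trivial weight exposed, and the geometric half of `LargePSpec` — part 3 (`AlphaInputsT3ACHistories`) re-read on `OfV2.dataT3c`

Lane `pub-balaban3d`, seat alpha-1 (route owner RULING g16-№2).  Same constructions and proofs as part 3 with `pkgAt ↦ pkgAtV2` and the
(40)-support `Adm`; the generic lemmas of part 3 (`coarsen_toFine`, `cornerSet_subset_plaqCover`, `plaqCover_subset_Lam_of_admissible`,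
`PkgAt.eps1_eq`) are reused by name.  HONESTY as in part 3: the trivial region history's weight is `≥ 1` at every datum (the lane's floor;
finding F-α1-3), so `NoTrivOnLarge` clause 2 fails for `lfDataT3c` whenever a large datum exists; `LargePSpec`'s datum-largeness conjunct and
`SmallFactor71` are (α) rows not delivered.  CONDITIONAL on the package; nothing of [Balaban1985UV3] is asserted.

References: T. Bałaban, Commun. Math. Phys. 102 (1985) 255–275 [Balaban1985UV3], (38)–(41) p.266, (47) p.267, (67) p.273.
-/

set_option autoImplicit false

noncomputable section

namespace Summit.QuantumFields.YangMills.Theorems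

open MeasureTheory
open Literature.MathematicalPhysics.QuantumFieldTheory.Balaban1983to89
open Literature.MathematicalPhysics.QuantumFieldTheory.Balaban1983to89.T3ContinuumYM3Torus
open Literature.MathematicalPhysics.QuantumFieldTheory.Balaban1983to89.T3UnitLawDensityEML (ℰp)
open Literature.MathematicalPhysics.QuantumFieldTheory.Balaban1983to89.T3UnitScaleTilt (θBal)
open Literature.MathematicalPhysics.QuantumFieldTheory.Balaban1983to89.T3AlphaInputsAC
open Literature.MathematicalPhysics.QuantumFieldTheory.Balaban1983to89.T3AlphaInputsACSchemas
open Literature.MathematicalPhysics.QuantumFieldTheory.Balaban1985CMP102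
open Literature.MathematicalPhysics.QuantumFieldTheory.Balaban1985CMP102.Setting
open Summit.QuantumFields.Balaban3D.Carriers
open Summit.QuantumFields.Balaban3D.Proofs.Primitives
open Summit.QuantumFields.Balaban3D.Proofs.TowerAC
open Summit.QuantumFields.Balaban3D.Proofs.StandardAC
open Summit.QuantumFields.Balaban3D.Proofs.InputsAC

/-! ## §2 The history functional opened for the version-2 datum: `lfDataT3c`, `LFSum`, the trivial weight -/

section Histories

variable {F : T3Family} {𝔠 : AlphaConsts F.L (suGroupModel 2).N}

open Classical in
/-- **THE INTERFACE'S `LFData` FOR THE ASSEMBLED DATUM**: region histories := the lane's discrete histories `Carriers.Hist (F.P K) j` (the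
large-field plaquette sets `(P_i)_{i<j}`, finitely many on the finite torus); `trivReg := Hist.triv`; `assemble r v := r` — the lane's masses
have the large-field fields `(V_i)_{i<j}` of (41) already integrated out (the exact Radon–Nikodym transports of `MassesAC`), so the fibre
variable is dummy; `wt r v W := m_j(r, W) ≥ 0`; `LargeP r i := P_i(r)` for admissible `r` (`Carriers.Hist.Admissible` at the input's `M₁`, `Rcol`)
and `i < j`, else `∅`. [cite: Balaban1985UV3, (38)-(41) p.266] -/
def AlphaInputsT3AC.OfV2.lfDataT3c (h : AlphaInputsT3AC.OfV2 F 𝔠) (γ : ℝ) (hγ : 0 < γ) (hγ1 : γ ≤ (min 𝔠.gamma0 1) ^ 2)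
    (π : AlphaInputsT3AC.PolymerT3 F) : LFData (h.dataT3c γ hγ hγ1 π) where
  Reg := fun K j => Hist (F.P K) j
  regFintype := fun _ _ => inferInstance
  trivReg := fun K j => Hist.triv (F.P K) j
  assemble := fun _ _ r _ => r
  wt := fun K j r _ W => (inputOfAC 𝔠.lane (h.pkgAtV2 γ hγ hγ1 K).X (h.pkgAtV2 γ hγ hγ1 K).𝔖).W.mass j r W
  LargeP := fun K j r i =>
    if hij : i < j ∧ Hist.Admissible 𝔠.lane.carrier.M₁
        (rcolOf (T3Scales F γ hγ (hγ1.trans (sq_min_one_le _ 𝔠.gamma0_pos)) K) 𝔠.lane.carrier) j r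
    then r ⟨i, hij.1⟩ else ∅

variable (h : AlphaInputsT3AC.OfV2 F 𝔠) (γ : ℝ) (hγ : 0 < γ) (hγ1 : γ ≤ (min 𝔠.gamma0 1) ^ 2) (π : AlphaInputsT3AC.PolymerT3 F)

/-- The weight of `lfDataT3` is the mass (definitional; the fibre variable is dummy). [cite: Balaban1985UV3, (41) p.266] -/
theorem AlphaInputsT3AC.OfV2.lfDataT3c_wt_eq (K j : ℕ) (r : Hist (F.P K) j)
    (v : (i : Fin j) → GaugeField (F.P K) i (Matrix.specialUnitaryGroup (Fin 2) ℂ))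
    (W : GaugeField (F.P K) j (Matrix.specialUnitaryGroup (Fin 2) ℂ)) :
    (h.lfDataT3c γ hγ hγ1 π).wt K j r v W = (inputOfAC 𝔠.lane (h.pkgAtV2 γ hγ hγ1 K).X (h.pkgAtV2 γ hγ hγ1 K).𝔖).W.mass j r W := rfl

/-- The assembled history is the region history itself (definitional). [cite: Balaban1985UV3, (38) p.266] -/
theorem AlphaInputsT3AC.OfV2.lfDataT3c_assemble_eq (K j : ℕ) (r : Hist (F.P K) j)
    (v : (i : Fin j) → GaugeField (F.P K) i (Matrix.specialUnitaryGroup (Fin 2) ℂ)) :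
    (h.lfDataT3c γ hγ hγ1 π).assemble K j r v = r := rfl

/-- **`LFSum` FOR THE ASSEMBLED DATUM — PROVED**: the weight is non-negative, the trivial region history assembles to the trivial history, and
`LF_j(W)[Φ] = Σ_r ∫ wt(r, v, W)·e^{Φ(assemble r v)} dv` — here `Σ_h m_j(h, W)·e^{Φ(h)}` with the integrand constant in the dummy fibre variable
and `dv` a probability measure (product of normalised Haar measures). [cite: Balaban1985UV3, (41) p.266] -/
theorem AlphaInputsT3AC.OfV2.dataT3c_lfSum : LFSum (h.dataT3c γ hγ hγ1 π) (h.lfDataT3c γ hγ hγ1 π) := by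
  refine ⟨fun K j r v W => ?_, fun K j v => rfl, fun K j W Φ => ?_⟩
  · exact (inputOfAC 𝔠.lane (h.pkgAtV2 γ hγ hγ1 K).X (h.pkgAtV2 γ hγ hγ1 K).𝔖).W.mass_nonneg j r W
  · show ∑ r : Hist (F.P K) j, (inputOfAC 𝔠.lane (h.pkgAtV2 γ hγ hγ1 K).X (h.pkgAtV2 γ hγ hγ1 K).𝔖).W.mass j r W * Real.exp (Φ r) =
      ∑ r : Hist (F.P K) j, ∫ _v, (inputOfAC 𝔠.lane (h.pkgAtV2 γ hγ hγ1 K).X (h.pkgAtV2 γ hγ hγ1 K).𝔖).W.mass j r W * Real.exp (Φ r)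
        ∂Measure.pi fun i : Fin j => fieldMeasure (F.P K) (i : ℕ) (Matrix.specialUnitaryGroup (Fin 2) ℂ)
    refine Finset.sum_congr rfl fun r _ => ?_
    rw [integral_const, smul_eq_mul]
    simp

/-- **THE TRIVIAL REGION HISTORY'S WEIGHT IS `≥ 1` AT EVERY DATUM** (the lane's floor `MassesAC.one_le_massRecAC_triv`): in particular it
NEVER vanishes — so the interface's `NoTrivOnLarge` clause 2 and the 18916 readiness clause `TrivTerm` («`wt triv = χ`») fail for `lfDataT3` at
any datum with a large plaquette (seat finding F-α1-3; print's trivial weight is the characteristic function «χ_k», (40)–(41) p.266, (47)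
p.267). [cite: Balaban1985UV3, (40)-(41) p.266] -/
theorem AlphaInputsT3AC.OfV2.lfDataT3c_one_le_wt_trivReg (K j : ℕ)
    (v : (i : Fin j) → GaugeField (F.P K) i (Matrix.specialUnitaryGroup (Fin 2) ℂ))
    (W : GaugeField (F.P K) j (Matrix.specialUnitaryGroup (Fin 2) ℂ)) :
    1 ≤ (h.lfDataT3c γ hγ hγ1 π).wt K j ((h.lfDataT3c γ hγ hγ1 π).trivReg K j) v W :=
  one_le_stdTowerInputAC_mass_triv (h.pkgAtV2 γ hγ hγ1 K).X 𝔠.lane.carrier (h.pkgAtV2 γ hγ hγ1 K).𝔖 j W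

/-- Hence the trivial weight never vanishes. [cite: Balaban1985UV3, (41) p.266] -/
theorem AlphaInputsT3AC.OfV2.lfDataT3c_wt_trivReg_ne_zero (K j : ℕ)
    (v : (i : Fin j) → GaugeField (F.P K) i (Matrix.specialUnitaryGroup (Fin 2) ℂ))
    (W : GaugeField (F.P K) j (Matrix.specialUnitaryGroup (Fin 2) ℂ)) :
    (h.lfDataT3c γ hγ hγ1 π).wt K j ((h.lfDataT3c γ hγ hγ1 π).trivReg K j) v W ≠ 0 :=
  ne_of_gt (lt_of_lt_of_le one_pos (h.lfDataT3c_one_le_wt_trivReg γ hγ hγ1 π K j v W))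

/-- The weight vanishes, pointwise, on inadmissible region histories (`StandardAC.stdTowerInputAC_mass_eq_zero_of_not_admissible`).
[cite: Balaban1985UV3, pp.267-268] -/
theorem AlphaInputsT3AC.OfV2.lfDataT3c_wt_eq_zero_of_not_admissible (K j : ℕ) (r : Hist (F.P K) j)
    (hr : ¬ Hist.Admissible 𝔠.lane.carrier.M₁
      (rcolOf (T3Scales F γ hγ (hγ1.trans (sq_min_one_le _ 𝔠.gamma0_pos)) K) 𝔠.lane.carrier) j r)
    (v : (i : Fin j) → GaugeField (F.P K) i (Matrix.specialUnitaryGroup (Fin 2) ℂ))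
    (W : GaugeField (F.P K) j (Matrix.specialUnitaryGroup (Fin 2) ℂ)) :
    (h.lfDataT3c γ hγ hγ1 π).wt K j r v W = 0 :=
  stdTowerInputAC_mass_eq_zero_of_not_admissible (h.pkgAtV2 γ hγ hγ1 K).X 𝔠.lane.carrier (h.pkgAtV2 γ hγ hγ1 K).𝔖 j r W hr

/-- `LargeP` lists large-field plaquettes only below the history's level: `LargeP K j r i = ∅` for `j ≤ i`. [cite: Balaban1985UV3, (38) p.266] -/
theorem AlphaInputsT3AC.OfV2.lfDataT3c_largeP_of_le (K j : ℕ) (r : Hist (F.P K) j) (i : ℕ) (hi : j ≤ i) :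
    (h.lfDataT3c γ hγ hγ1 π).LargeP K j r i = ∅ := by
  dsimp only [AlphaInputsT3AC.OfV2.lfDataT3c]
  rw [dif_neg]
  exact fun hij => absurd hij.1 (not_lt.mpr hi)

/-- … and nothing for inadmissible region histories. [cite: Balaban1985UV3, pp.267-268] -/
theorem AlphaInputsT3AC.OfV2.lfDataT3c_largeP_of_not_admissible (K j : ℕ) (r : Hist (F.P K) j)
    (hr : ¬ Hist.Admissible 𝔠.lane.carrier.M₁
      (rcolOf (T3Scales F γ hγ (hγ1.trans (sq_min_one_le _ 𝔠.gamma0_pos)) K) 𝔠.lane.carrier) j r) (i : ℕ) :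
    (h.lfDataT3c γ hγ hγ1 π).LargeP K j r i = ∅ := by
  dsimp only [AlphaInputsT3AC.OfV2.lfDataT3c]
  rw [dif_neg]
  exact fun hij => hr hij.2

/-- For an admissible region history and `i < j`, `LargeP K j r i` IS its recorded level-`i` large-field set `P_i(r)`. [cite: Balaban1985UV3, (38) p.266] -/
theorem AlphaInputsT3AC.OfV2.lfDataT3c_largeP_of_admissible (K j : ℕ) (r : Hist (F.P K) j)
    (hr : Hist.Admissible 𝔠.lane.carrier.M₁
      (rcolOf (T3Scales F γ hγ (hγ1.trans (sq_min_one_le _ 𝔠.gamma0_pos)) K) 𝔠.lane.carrier) j r) (i : ℕ) (hi : i < j) :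
    (h.lfDataT3c γ hγ hγ1 π).LargeP K j r i = r ⟨i, hi⟩ := by
  dsimp only [AlphaInputsT3AC.OfV2.lfDataT3c]
  rw [dif_pos ⟨hi, hr⟩]

end Histories

/-! ## §3 The geometric half of `LargePSpec` for `lfDataT3cV2` -/

section LargePGeom

open Literature.MathematicalPhysics.QuantumFieldTheory.Balaban1983to89.B10Eq38TorusDomains (toFine cornerSet plaqsIn mem_plaqsIn_iff)
open Literature.MathematicalPhysics.QuantumFieldTheory.Balaban1983to89.B10Eq42TorusConstraint (lam42 lam42_of_lt)

variable {F : T3Family} {𝔠 : AlphaConsts F.L (suGroupModel 2).N}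
  (h : AlphaInputsT3AC.OfV2 F 𝔠) (γ : ℝ) (hγ : 0 < γ) (hγ1 : γ ≤ (min 𝔠.gamma0 1) ^ 2) (π : AlphaInputsT3AC.PolymerT3 F)

/-- Below the top index the assembled datum's `Λ_i(h)` IS the lane's `Carriers.Lam` (definitional up to `lam42_of_lt`). [cite: Balaban1985UV3, (40)-(42) p.266] -/
theorem AlphaInputsT3AC.OfV2.dataT3c_Λ_eq_Lam (K j : ℕ) (r : Hist (F.P K) j) (i : ℕ) (hi : i < j) :
    (h.dataT3c γ hγ hγ1 π).Λ K j r i =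
      Lam 𝔠.lane.carrier.M₁
        (rcolOf (T3Scales F γ hγ (hγ1.trans (sq_min_one_le _ 𝔠.gamma0_pos)) K) 𝔠.lane.carrier) r i := by
  show lam42 _ j i = _
  rw [lam42_of_lt hi]
  rfl

/-- **`LargePSpec`, GEOMETRIC HALF, FOR `lfDataT3` — PROVED**: if `p′ ∈ LargeP K j r i` (so `r` is admissible, `i < j`, `p′ ∈ P_i(r)`) and
`j ≤ K`, then `i < j` and `p′ ∈ plaqsIn i (Λ_i(assemble r v))` — its four corners lie in `Λ_i = Ω_i ∖ Ω_{i+1}` of the history ((67) p.273 «a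
plaquette p′ ⊂ Λ_j»).  The remaining conjunct of `LargePSpec` (the `i`-fold `blockAvg ℰp` average of the composite minimiser is `θBal(K−i)`-LARGE
at `p′`) is the lane's (α) row `hLF67`, stated there on LIFTED minimisers — not derived here. [cite: Balaban1985UV3, (67) p.273] -/
theorem AlphaInputsT3AC.OfV2.lfDataT3c_largeP_geom (K j : ℕ) (hj : j ≤ K) (r : Hist (F.P K) j)
    (v : (i : Fin j) → GaugeField (F.P K) i (Matrix.specialUnitaryGroup (Fin 2) ℂ)) (i : ℕ) (p' : Plaq (F.P K) i)
    (hp : p' ∈ (h.lfDataT3c γ hγ hγ1 π).LargeP K j r i) :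
    i < j ∧ p' ∈ plaqsIn i ((h.dataT3c γ hγ hγ1 π).Λ K j ((h.lfDataT3c γ hγ hγ1 π).assemble K j r v) i) := by
  by_cases hij : i < j ∧ Hist.Admissible 𝔠.lane.carrier.M₁
      (rcolOf (T3Scales F γ hγ (hγ1.trans (sq_min_one_le _ 𝔠.gamma0_pos)) K) 𝔠.lane.carrier) j r
  · rw [h.lfDataT3c_largeP_of_admissible γ hγ hγ1 π K j r hij.2 i hij.1] at hp
    refine ⟨hij.1, ?_⟩
    rw [h.lfDataT3c_assemble_eq γ hγ hγ1 π, h.dataT3c_Λ_eq_Lam γ hγ hγ1 π K j r i hij.1, mem_plaqsIn_iff]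
    have hiK : i ≤ (F.P K).m + (F.P K).K := by
      show i ≤ F.m + K
      omega
    exact (cornerSet_subset_plaqCover hiK p').trans
      (plaqCover_subset_Lam_of_admissible _ _ j r hij.2 i hij.1 p' hp)
  · exfalso
    have h0 : (h.lfDataT3c γ hγ hγ1 π).LargeP K j r i = ∅ := by
      dsimp only [AlphaInputsT3AC.OfV2.lfDataT3c]
      rw [dif_neg hij]
    rw [h0] at hp
    simp at hp

end LargePGeom

end Summit.QuantumFields.YangMills.Theorems

end
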